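import Literature.MathematicalPhysics.KineticTheory.LangevinChainLyapunov
import Literature.MathematicalPhysics.KineticTheory.LangevinChainGibbs
import Literature.Analysis.Distribution.Hypoelliptic
import Mathlib.LinearAlgebra.Matrix.Trace
import HarnessLib

/-!
# The pinned chain: Hörmander's bracket condition (CEHR Prop. 4.1) PROVED, and the smooth-density fact from Hörmander's theorem

Trunk T-KINETIC (Literature/MathematicalPhysics/KineticTheory). Third decomposition step for the
named fact `CuneoEckmannHairerReyBellet2018_pinnedChain` (`LangevinChainNESS.lean`; provefact
unit `Literature.MathematicalPhysics.KineticTheory.HeatConduction.CuneoEckmannHairerReyBellet2018_pinnedChain`).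
`LangevinChainLyapunov.lean` reduced the fact to two named facts, the Lyapunov/semigroup fact
`CuneoEckmannHairerReyBellet2018_lyapunov` (SDE theory, CEHR Thm 5.1) and the smooth-density
fact `CuneoEckmannHairerReyBellet2018_smoothDensity` ("every finite measure `μ` with
`∫ L f dμ = 0` for `f ∈ C_c^∞` has a smooth density"). This file PROVES the second from
Hörmander's hypoellipticity theorem (`Literature.Analysis.Distribution.Hormander1967_thm11`,
`Literature/Analysis/Distribution/Hypoelliptic.lean`), i.e. it proves everything chain-specific:

* `OscillatorChain.dPotential`, `OscillatorChain.hessPotential` with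
  `partialQ_hamiltonian_eq_dPotential` — closed forms of `∂_{q_i}H = ∂Φ/∂q_i` and of the
  Hessian `∂²Φ/∂q_j∂q_i` of the potential energy (tridiagonal: `hessPotential_eq_zero_of_le`;
  sub-diagonal entry `-V''(q_{j+1} - q_j)`: `hessPotential_succ`).
* `OscillatorChain.drift` — the drift `Y(q,p) = (p, -∇_qH - γ1_B p)` of the SDE (2.2) (CEHR
  eq. (3.2): `L = X_0 + ∑ X_{b,i}²` with `X_0 = Y`), its derivative (`fderiv_drift_apply`) and
  divergence `div Y = -2γ` (`fieldDiv_drift`); `generator_eq_fderiv_drift_add`: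
  `L f = Y·∇f + γ(T_L ∂²_{p_0} + T_R ∂²_{p_{N-1}}) f`.
* `OscillatorChain.generator_exp_mul_hamiltonian(_le)` — **CEHR eq. (3.3), PROVED**:
  `L e^{θH} = θγ ∑_b ([θT_b - 1]p_b² + T_b) e^{θH} ≤ C_* e^{θH}`, `C_* = θγ(T_L + T_R)`, for
  `0 ≤ θ ≤ 1/max(T_L,T_R)` (the infinitesimal form of (3.4); `C¹` potentials suffice).
* `OscillatorChain.bathField`, `OscillatorChain.adjointDrift`,
  `OscillatorChain.hormanderFamily` — the data `X_L = √(γT_L)∂_{p_0}`, `X_R = √(γT_R)∂_{p_{N-1}}`,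
  `X₀ = -Y` of the Fokker–Planck operator `L* = X_L² + X_R² + X₀ + 2γ` in Hörmander's form
  (1.6), and `hormanderTranspose_eq_generator`: its formal transpose is the generator,
  `ᵗ(L*) f = L f` (so a weakly stationary measure `μ`, `∫ Lf dμ = 0`, is a distribution solution
  of `L* μ = 0`).
* `OscillatorChain.isBracketGenerating_hormanderFamily` — **CEHR Proposition 4.1 for the chain,
  PROVED** ("Under Conditions C1 and C2, the system (2.2) satisfies H1"): for smooth `U, V`
  with `V'' ≠ 0` everywhere (C2 with `ℓ = 1`) and `γ T_L > 0` (the chain is controlled by its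
  left end, C1), the iterated brackets `Z_0 = X_L`, `Z_{k+1} = [X₀, Z_k]` already span phase
  space at every point: `bracketSeq_triangular` shows that, ranking the coordinate directions
  `∂_{p_0} ≺ ∂_{q_0} ≺ ∂_{p_1} ≺ ∂_{q_1} ≺ ⋯`, `Z_k` has vanishing coordinates of rank `> k` and
  a nowhere-vanishing coordinate of rank `k` (it is `±√(γT_L) ∏_{j<i} V''(q_{j+1} - q_j)`), which
  is the chain version of the printed induction (p. 10: "`[∂_{p_v}, X̄_0] = -∂_{q_v} + γ_v ∂_{p_v}`
  … `∇_{p_v} ∈ M ⇒ ∇_{q_v} ∈ M`", and the commutator formula of the proof, "`[∂_{q_b}, X̄_0] = (∂∇U_b)(q_b)·∇_{p_b} -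
  ∑_{e=(b,v)} (∂∇V_e)(δq_e)·(∇_{p_v} - ∇_{p_b})`" with the non-degeneracy of `V_e`).
* `CuneoEckmannHairerReyBellet2018_smoothDensity_of_hormander` — **the smooth-density fact from
  `Hormander1967_thm11`, PROVED**, and the assembly
  `CuneoEckmannHairerReyBellet2018_pinnedChain_of_lyapunov_of_hormander`:
  the weak-stationarity fact follows from the Lyapunov fact and Hörmander's Theorem 1.1.

So after this file the discharge of `CuneoEckmannHairerReyBellet2018_pinnedChain` rests on
exactly two named facts, both general theory absent from Mathlib: the SDE/Lyapunov fact
`CuneoEckmannHairerReyBellet2018_lyapunov` (strong solutions, Feller property, (3.4) and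
Thm 5.1 of CEHR) and Hörmander's Theorem 1.1 (`Literature.Analysis.Distribution.Hormander1967_thm11`).

## References

* N. Cuneo, J.-P. Eckmann, M. Hairer, L. Rey-Bellet, *Non-equilibrium steady states for
  networks of oscillators*, Electron. J. Probab. 23 (2018) no. 55 (arXiv:1712.09413): §3 eq.
  (3.2) (`L = X_0 + ∑ X_{b,i}²`), §3.1 (`L*` the formal adjoint), condition H1 and the family
  `A_k` (p. 7), eq. (3.3) (p. 7), Prop. 3.2, Prop. 4.1 and its proof (p. 10). Page numbers
  refer to the arXiv version.
* L. Hörmander, *Hypoelliptic second order differential equations*, Acta Math. 119 (1967)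
  147–171, Thm 1.1.

## Design choices

* The chain has `N = n ≥ 1` sites; the bath sites are `⟨0, _⟩` and `⟨N-1, _⟩ : Fin N`
  (`bathSite`), equal when `N = 1` (then both baths act on the single site and
  `bathWeight = 2` there, matching `OscillatorChain.generator`).
* `X_b = √(γT_b) ∂_{p_b}` requires `γT_b ≥ 0` for `X_b² = γT_b ∂²_{p_b}`
  (`hormanderTranspose_eq_generator`); the bracket condition uses only `X_L` and `γT_L > 0`.
* Only the ITERATED brackets `[X₀, [X₀, …, X_L]]` of Hörmander's list are needed for the chain
  with `V'' ≠ 0`; CEHR's general Prop. 4.1 (networks, `V` non-degenerate of order `ℓ`) also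
  uses brackets with the `∂_{q_b}` and smooth multiples, not formalised here.
* `unitQ i = (e_i, 0)`, `unitP i = (0, e_i)` are `def`s with `rfl` lemmas to the literals used
  in `LangevinChainNESSProofs.lean` (`unitQ_eq`, `unitP_eq`).
-/

noncomputable section

open MeasureTheory Filter Topology Set Function Finset
open scoped ContDiff NNReal ENNReal BigOperators

namespace Literature.MathematicalPhysics.KineticTheory.HeatConduction

variable {N : ℕ}

/-! ### Coordinates on phase space -/

/-- The coordinate vector `(e_i, 0)` of phase space (position direction `q_i`). [folklore] -/
def unitQ (i : Fin N) : PhaseSpace N := (Pi.single i 1, 0)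

/-- The coordinate vector `(0, e_i)` of phase space (momentum direction `p_i`). [folklore] -/
def unitP (i : Fin N) : PhaseSpace N := (0, Pi.single i 1)

/-- The position part of `(e_i, 0)` is `e_i`. [folklore] -/
@[simp] theorem unitQ_fst (i : Fin N) : (unitQ i).1 = Pi.single i 1 := rfl

/-- The momentum part of `(e_i, 0)` vanishes. [folklore] -/
@[simp] theorem unitQ_snd (i : Fin N) : (unitQ i).2 = 0 := rfl

/-- The position part of `(0, e_i)` vanishes. [folklore] -/
@[simp] theorem unitP_fst (i : Fin N) : (unitP i).1 = 0 := rfl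

/-- The momentum part of `(0, e_i)` is `e_i`. [folklore] -/
@[simp] theorem unitP_snd (i : Fin N) : (unitP i).2 = Pi.single i 1 := rfl

/-- `unitQ i` is the literal `(e_i, 0)` of `LangevinChainNESSProofs`. [folklore] -/
theorem unitQ_eq (i : Fin N) : unitQ i = ((Pi.single i 1, 0) : PhaseSpace N) := rfl

/-- `unitP i` is the literal `(0, e_i)` of `LangevinChainNESSProofs`. [folklore] -/
theorem unitP_eq (i : Fin N) : unitP i = ((0, Pi.single i 1) : PhaseSpace N) := rfl

/-- `(q + s e_j)_m = q_m + s [m = j]`. [folklore] -/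
theorem pi_add_smul_single_apply (q : Fin N → ℝ) (s : ℝ) (j m : Fin N) :
    (q + s • (Pi.single j (1 : ℝ) : Fin N → ℝ)) m = q m + s * (if m = j then 1 else 0) := by
  simp [Pi.single_apply]

namespace OscillatorChain

variable (P : OscillatorChain)

/-! ### Closed forms of `∂Φ/∂q_i` and `∂²Φ/∂q_j ∂q_i` -/

/-- Closed form of the force component `∂Φ/∂q_i` of the potential energy
`Φ(q) = ∑_k U(q_k) + ∑_{l = k+1} V(q_l - q_k)`:
`∂Φ/∂q_i = U'(q_i) + ∑_{l = k+1} V'(q_l - q_k) ([l = i] - [k = i])`, i.e.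
`U'(q_i) + V'(q_i - q_{i-1}) - V'(q_{i+1} - q_i)` with the boundary terms absent at the ends of
the chain. [folklore] -/
def dPotential (N : ℕ) (i : Fin N) (q : Fin N → ℝ) : ℝ :=
  deriv P.U (q i) + ∑ k : Fin N, ∑ l : Fin N,
    if l.val = k.val + 1 then
      deriv P.V (q l - q k) * ((if l = i then 1 else 0) - (if k = i then 1 else 0)) else 0

/-- Closed form of the Hessian entry `∂²Φ/∂q_j ∂q_i`:
`U''(q_i) [i = j] + ∑_{l = k+1} V''(q_l - q_k) ([l = j] - [k = j]) ([l = i] - [k = i])`.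
[folklore] -/
def hessPotential (N : ℕ) (i j : Fin N) (q : Fin N → ℝ) : ℝ :=
  deriv (deriv P.U) (q i) * (if i = j then 1 else 0) + ∑ k : Fin N, ∑ l : Fin N,
    if l.val = k.val + 1 then
      deriv (deriv P.V) (q l - q k) * ((if l = j then 1 else 0) - (if k = j then 1 else 0)) *
        ((if l = i then 1 else 0) - (if k = i then 1 else 0)) else 0

/-- `t ↦ Φ(q[i ↦ t])` has derivative `∂Φ/∂q_i` (closed form) at `t = q_i`. [folklore] -/
theorem hasDerivAt_potential_update (hU : Differentiable ℝ P.U) (hV : Differentiable ℝ P.V)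
    (N : ℕ) (q : Fin N → ℝ) (i : Fin N) :
    HasDerivAt (fun t => P.potential N (Function.update q i t)) (P.dPotential N i q) (q i) := by
  unfold potential dPotential
  refine HasDerivAt.add ?_ ?_
  · -- pinning terms
    have h : ∀ k ∈ (univ : Finset (Fin N)), HasDerivAt (fun t => P.U (Function.update q i t k))
        (if k = i then deriv P.U (q i) else 0) (q i) := by
      intro k _
      by_cases hk : k = i
      · subst hk
        simp only [Function.update_self, if_true]
        exact (hU _).hasDerivAt
      · simp only [Function.update_of_ne hk, hk, if_false]
        exact hasDerivAt_const _ _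
    have := HasDerivAt.fun_sum h
    simpa using this
  · -- interaction terms
    refine HasDerivAt.fun_sum fun k _ => HasDerivAt.fun_sum fun l _ => ?_
    by_cases hlk : l.val = k.val + 1
    · simp only [hlk, if_true]
      have ha : HasDerivAt (fun t => Function.update q i t l - Function.update q i t k)
          ((if l = i then 1 else 0) - (if k = i then 1 else 0)) (q i) := by
        refine HasDerivAt.sub ?_ ?_
        · by_cases hl : l = i
          · subst hl; simp only [Function.update_self, if_true]; exact hasDerivAt_id _
          · simp only [Function.update_of_ne hl, hl, if_false]; exact hasDerivAt_const _ _
        · by_cases hk : k = i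
          · subst hk; simp only [Function.update_self, if_true]; exact hasDerivAt_id _
          · simp only [Function.update_of_ne hk, hk, if_false]; exact hasDerivAt_const _ _
      have hcomp := ((hV _).hasDerivAt).comp (q i) ha
      have heval : Function.update q i (q i) l - Function.update q i (q i) k = q l - q k := by
        simp
      rw [heval] at hcomp
      exact hcomp
    · simp only [hlk, if_false]
      exact hasDerivAt_const _ _

/-- **Closed form of `∂_{q_i} H`**: for differentiable potentials,
`∂_{q_i} H (q, p) = ∂Φ/∂q_i (q)` with `∂Φ/∂q_i` as in `dPotential`. [folklore] -/
theorem partialQ_hamiltonian_eq_dPotential (hU : Differentiable ℝ P.U)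
    (hV : Differentiable ℝ P.V) (N : ℕ) (x : PhaseSpace N) (i : Fin N) :
    partialQ i (P.hamiltonian N) x = P.dPotential N i x.1 := by
  rw [partialQ_hamiltonian_eq]
  exact (P.hasDerivAt_potential_update hU hV N x.1 i).deriv

/-- `∂Φ/∂q_i` is smooth in `q` for smooth potentials. [folklore] -/
theorem contDiff_dPotential (hU : ContDiff ℝ ∞ P.U) (hV : ContDiff ℝ ∞ P.V) (N : ℕ)
    (i : Fin N) : ContDiff ℝ ∞ (P.dPotential N i) := by
  have hU' : ContDiff ℝ ∞ (deriv P.U) := hU.deriv'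
  have hV' : ContDiff ℝ ∞ (deriv P.V) := hV.deriv'
  have hq : ∀ m : Fin N, ContDiff ℝ ∞ fun q : Fin N → ℝ => q m := fun m => contDiff_apply ℝ ℝ m
  unfold dPotential
  refine (hU'.comp (hq i)).add (ContDiff.sum fun k _ => ContDiff.sum fun l _ => ?_)
  by_cases hlk : l.val = k.val + 1
  · simp only [hlk, if_true]
    exact (hV'.comp ((hq l).sub (hq k))).mul contDiff_const
  · simp only [hlk, if_false]
    exact contDiff_const

/-- `s ↦ ∂Φ/∂q_i (q + s e_j)` has derivative `∂²Φ/∂q_j∂q_i (q)` (closed form) at `s = 0`.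
[folklore] -/
theorem hasDerivAt_dPotential_add_smul (hU : Differentiable ℝ (deriv P.U))
    (hV : Differentiable ℝ (deriv P.V)) (N : ℕ) (q : Fin N → ℝ) (i j : Fin N) :
    HasDerivAt (fun s : ℝ => P.dPotential N i (q + s • Pi.single j 1))
      (P.hessPotential N i j q) 0 := by
  have hlin : HasDerivAt (fun s : ℝ => q + s • (Pi.single j (1 : ℝ) : Fin N → ℝ))
      (Pi.single j 1) 0 := by
    simpa using ((hasDerivAt_id (0 : ℝ)).smul_const (Pi.single j (1 : ℝ) : Fin N → ℝ)).const_add q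
  have hco : ∀ m : Fin N, HasDerivAt (fun s : ℝ => (q + s • (Pi.single j (1 : ℝ) : Fin N → ℝ)) m)
      (if m = j then 1 else 0) 0 := fun m => by
    have := (hasDerivAt_pi.1 hlin) m
    simpa [Pi.single_apply] using this
  have h0 : ∀ m : Fin N, (q + (0 : ℝ) • (Pi.single j (1 : ℝ) : Fin N → ℝ)) m = q m := fun m => by
    simp
  unfold dPotential hessPotential
  refine HasDerivAt.add ?_ ?_
  · have := ((hU _).hasDerivAt).comp (0 : ℝ) (hco i)
    simpa [Function.comp_def, h0] using this
  · refine HasDerivAt.fun_sum fun k _ => HasDerivAt.fun_sum fun l _ => ?_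
    by_cases hlk : l.val = k.val + 1
    · simp only [hlk, if_true]
      have hcomp := ((((hV _).hasDerivAt).comp (0 : ℝ) ((hco l).sub (hco k))).mul_const
        ((if l = i then (1 : ℝ) else 0) - (if k = i then 1 else 0)))
      simpa [Function.comp_def, h0] using hcomp
    · simp only [hlk, if_false]
      exact hasDerivAt_const _ _

/-- Far off the tridiagonal, the Hessian of `Φ` vanishes: `∂²Φ/∂q_j∂q_i = 0` for `i ≥ j + 2`
(each `V`-bond couples nearest neighbours only). [folklore] -/
theorem hessPotential_eq_zero_of_le (N : ℕ) {i j : Fin N} (h : j.val + 2 ≤ i.val)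
    (q : Fin N → ℝ) : P.hessPotential N i j q = 0 := by
  unfold hessPotential
  have hij : i ≠ j := by intro e; subst e; omega
  simp only [hij, if_false, mul_zero, zero_add]
  refine Finset.sum_eq_zero fun k _ => Finset.sum_eq_zero fun l _ => ?_
  simp only [Fin.ext_iff]
  split_ifs <;> first | (exfalso; omega) | simp

/-- The sub-diagonal Hessian entry: `∂²Φ/∂q_j∂q_{j+1} = -V''(q_{j+1} - q_j)`. [folklore] -/
theorem hessPotential_succ (N : ℕ) {i j : Fin N} (h : i.val = j.val + 1) (q : Fin N → ℝ) :
    P.hessPotential N i j q = -deriv (deriv P.V) (q i - q j) := by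
  unfold hessPotential
  have hij : i ≠ j := by intro e; subst e; omega
  simp only [hij, if_false, mul_zero, zero_add]
  have key : ∀ k l : Fin N,
      (if l.val = k.val + 1 then
        deriv (deriv P.V) (q l - q k) * ((if l = j then 1 else 0) - (if k = j then 1 else 0)) *
          ((if l = i then 1 else 0) - (if k = i then 1 else 0)) else (0 : ℝ)) =
      if k = j then (if l = i then -deriv (deriv P.V) (q l - q k) else 0) else 0 := by
    intro k l
    simp only [Fin.ext_iff]
    split_ifs <;> first | (exfalso; omega) | simp
  simp_rw [key]
  simp

/-! ### Linear algebra on phase space: expansion in the coordinate vectors -/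

/-- `v = ∑_i v.1 i • (e_i, 0) + ∑_i v.2 i • (0, e_i)`. [folklore] -/
theorem _root_.Literature.MathematicalPhysics.KineticTheory.HeatConduction.eq_sum_unitQ_add_sum_unitP (v : PhaseSpace N) :
    v = (∑ i, v.1 i • unitQ i) + ∑ i, v.2 i • unitP i := by
  ext j <;> simp [unitQ, unitP, Prod.fst_sum, Prod.snd_sum, Finset.sum_apply, Pi.single_apply]

/-- A (continuous) linear map out of phase space is determined by its values on the coordinate
vectors: `L v = ∑_i v.1 i • L (e_i, 0) + ∑_i v.2 i • L (0, e_i)`. [folklore] -/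
theorem _root_.Literature.MathematicalPhysics.KineticTheory.HeatConduction.clm_apply_eq_sum {F : Type*} [NormedAddCommGroup F]
    [NormedSpace ℝ F] (L : PhaseSpace N →L[ℝ] F) (v : PhaseSpace N) :
    L v = (∑ i, v.1 i • L (unitQ i)) + ∑ i, v.2 i • L (unitP i) := by
  conv_lhs => rw [eq_sum_unitQ_add_sum_unitP v]
  simp only [map_add, map_sum, map_smul]

/-! ### The Langevin drift and its derivative -/

/-- The bath multiplicity of site `i`: `[i = 0] + [i = N - 1]` (so `2` on the single site of a
one-site chain, where both baths act). [folklore] -/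
def bathWeight (N : ℕ) (i : Fin N) : ℝ :=
  (if i.val = 0 then 1 else 0) + (if i.val = N - 1 then 1 else 0)

/-- `∑_i ([i = 0] + [i = N-1]) = 2` for `N ≥ 1`. [folklore] -/
theorem sum_bathWeight {N : ℕ} (hN : 0 < N) : ∑ i : Fin N, bathWeight N i = 2 := by
  unfold bathWeight
  rw [Finset.sum_add_distrib]
  have h1 : ∑ i : Fin N, (if i.val = 0 then (1 : ℝ) else 0) = 1 := by
    rw [Finset.sum_eq_single_of_mem (⟨0, hN⟩ : Fin N) (mem_univ _)]
    · simp
    · intro b _ hb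
      rw [if_neg]
      exact fun h => hb (Fin.ext h)
  have h2 : ∑ i : Fin N, (if i.val = N - 1 then (1 : ℝ) else 0) = 1 := by
    rw [Finset.sum_eq_single_of_mem (⟨N - 1, by omega⟩ : Fin N) (mem_univ _)]
    · simp
    · intro b _ hb
      rw [if_neg]
      exact fun h => hb (Fin.ext h)
  rw [h1, h2]
  norm_num

/-- The drift vector field `Y(q, p) = (p, -∇_q H - γ 1_B p)` of the Langevin system (CEHR (2.2),
(3.2)): `dq_i = p_i dt`, `dp_i = (-∂_{q_i} H - γ ([i = 0] + [i = N-1]) p_i) dt + noise`, so that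
`L f = Y·∇f + γ (T_L ∂²_{p_0} + T_R ∂²_{p_{N-1}}) f` (`generator_eq_fderiv_drift_add`).
[cite: CuneoEckmannHairerReyBellet2018, eq. (3.2)] -/
def drift (N : ℕ) (x : PhaseSpace N) : PhaseSpace N :=
  (x.2, fun i => -partialQ i (P.hamiltonian N) x - P.γ * bathWeight N i * x.2 i)

/-- Closed form of the drift for differentiable potentials. [folklore] -/
theorem drift_eq (hU : Differentiable ℝ P.U) (hV : Differentiable ℝ P.V) (N : ℕ) :
    P.drift N = fun x => (x.2, fun i => -P.dPotential N i x.1 - P.γ * bathWeight N i * x.2 i) := by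
  funext x
  simp only [drift, P.partialQ_hamiltonian_eq_dPotential hU hV]

/-- The drift is smooth for smooth potentials. [folklore] -/
theorem contDiff_drift (hU : ContDiff ℝ ∞ P.U) (hV : ContDiff ℝ ∞ P.V) (N : ℕ) :
    ContDiff ℝ ∞ (P.drift N) := by
  rw [P.drift_eq (hU.differentiable (by simp)) (hV.differentiable (by simp))]
  refine contDiff_snd.prodMk (contDiff_pi.2 fun i => ?_)
  exact (((P.contDiff_dPotential hU hV N i).comp contDiff_fst).neg).sub
    (contDiff_const.mul ((contDiff_apply ℝ ℝ i).comp contDiff_snd))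

/-- `∂Y/∂p_j = (e_j, -γ ([j = 0] + [j = N-1]) e_j)`. [folklore] -/
theorem hasLineDerivAt_drift_unitP (hU : ContDiff ℝ ∞ P.U) (hV : ContDiff ℝ ∞ P.V) (N : ℕ)
    (x : PhaseSpace N) (j : Fin N) :
    HasLineDerivAt ℝ (P.drift N)
      ((Pi.single j 1, fun i => if i = j then -(P.γ * bathWeight N i) else 0) : PhaseSpace N)
      x (unitP j) := by
  unfold HasLineDerivAt
  rw [P.drift_eq (hU.differentiable (by simp)) (hV.differentiable (by simp))]
  simp only [unitP_eq, add_smul_unitP_fst, add_smul_unitP_snd]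
  have hlin : HasDerivAt (fun t : ℝ => x.2 + t • (Pi.single j (1 : ℝ) : Fin N → ℝ))
      (Pi.single j 1) 0 := by
    simpa using ((hasDerivAt_id (0 : ℝ)).smul_const (Pi.single j (1 : ℝ) : Fin N → ℝ)).const_add
      x.2
  have hco : ∀ m : Fin N, HasDerivAt (fun t : ℝ => (x.2 + t • (Pi.single j (1 : ℝ) : Fin N → ℝ)) m)
      (if m = j then 1 else 0) 0 := fun m => by
    have := (hasDerivAt_pi.1 hlin) m
    simpa [Pi.single_apply] using this
  refine hlin.prodMk (hasDerivAt_pi.2 fun i => ?_)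
  have h2 := ((hco i).const_mul (P.γ * bathWeight N i)).const_sub (-P.dPotential N i x.1)
  convert h2 using 1
  split_ifs <;> ring

/-- `∂Y/∂q_j = (0, -(∂²Φ/∂q_j∂q_i)_i)`. [folklore] -/
theorem hasLineDerivAt_drift_unitQ (hU : ContDiff ℝ ∞ P.U) (hV : ContDiff ℝ ∞ P.V) (N : ℕ)
    (x : PhaseSpace N) (j : Fin N) :
    HasLineDerivAt ℝ (P.drift N) ((0, fun i => -P.hessPotential N i j x.1) : PhaseSpace N)
      x (unitQ j) := by
  unfold HasLineDerivAt
  rw [P.drift_eq (hU.differentiable (by simp)) (hV.differentiable (by simp))]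
  simp only [unitQ_eq, add_smul_unitQ_fst, add_smul_unitQ_snd]
  refine (hasDerivAt_const (0 : ℝ) x.2).prodMk (hasDerivAt_pi.2 fun i => ?_)
  have hU' : ContDiff ℝ ∞ (deriv P.U) := hU.deriv'
  have hV' : ContDiff ℝ ∞ (deriv P.V) := hV.deriv'
  have hU2 : Differentiable ℝ (deriv P.U) := hU'.differentiable (by simp)
  have hV2 : Differentiable ℝ (deriv P.V) := hV'.differentiable (by simp)
  have h := (P.hasDerivAt_dPotential_add_smul hU2 hV2 N x.1 i j).neg.sub_const
    (P.γ * bathWeight N i * x.2 i)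
  simpa using h

/-- **The derivative of the drift**: `DY(x) v = (v.2, -Hess Φ(q) v.1 - γ 1_B v.2)`, i.e.
`(DY(x) v).1 = v.2` and `(DY(x) v).2 i = -∑_j ∂²Φ/∂q_j∂q_i v.1 j - γ ([i=0]+[i=N-1]) v.2 i`.
[folklore] -/
theorem fderiv_drift_apply (hU : ContDiff ℝ ∞ P.U) (hV : ContDiff ℝ ∞ P.V) (N : ℕ)
    (x v : PhaseSpace N) :
    fderiv ℝ (P.drift N) x v =
      (v.2, fun i => -(∑ j, P.hessPotential N i j x.1 * v.1 j) - P.γ * bathWeight N i * v.2 i) := by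
  have hd : DifferentiableAt ℝ (P.drift N) x :=
    ((P.contDiff_drift hU hV N).differentiable (by simp)) x
  have hQ : ∀ j, fderiv ℝ (P.drift N) x (unitQ j) =
      ((0, fun i => -P.hessPotential N i j x.1) : PhaseSpace N) := fun j => by
    rw [← hd.lineDeriv_eq_fderiv]
    exact (P.hasLineDerivAt_drift_unitQ hU hV N x j).lineDeriv
  have hP : ∀ j, fderiv ℝ (P.drift N) x (unitP j) =
      ((Pi.single j 1, fun i => if i = j then -(P.γ * bathWeight N i) else 0) : PhaseSpace N) :=
    fun j => by
    rw [← hd.lineDeriv_eq_fderiv]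
    exact (P.hasLineDerivAt_drift_unitP hU hV N x j).lineDeriv
  rw [clm_apply_eq_sum]
  simp only [hQ, hP]
  ext i
  · simp [Prod.fst_sum, Finset.sum_apply, Pi.single_apply]
  · simp only [Prod.snd_add, Prod.snd_sum, Prod.smul_snd, Finset.sum_apply, Pi.add_apply,
      Pi.smul_apply, smul_eq_mul, mul_neg, Finset.sum_neg_distrib, mul_ite, mul_zero,
      Finset.sum_ite_eq, Finset.mem_univ, if_true]
    rw [Finset.sum_congr rfl fun j _ => mul_comm (v.1 j) (P.hessPotential N i j x.1)]
    ring

/-- **The divergence of the drift** is the constant `-γ ∑_i ([i=0]+[i=N-1]) = -2γ` (`N ≥ 1`):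
only the friction terms `-γ p_b ∂_{p_b}` contribute to `tr DY`. [folklore] -/
theorem fieldDiv_drift (hU : ContDiff ℝ ∞ P.U) (hV : ContDiff ℝ ∞ P.V) {N : ℕ} (hN : 0 < N)
    (x : PhaseSpace N) : Literature.Analysis.Distribution.fieldDiv (P.drift N) x = -(2 * P.γ) := by
  unfold Literature.Analysis.Distribution.fieldDiv
  classical
  let b := (Pi.basisFun ℝ (Fin N)).prod (Pi.basisFun ℝ (Fin N))
  rw [LinearMap.trace_eq_matrix_trace ℝ b, Matrix.trace]
  simp only [Matrix.diag_apply, LinearMap.toMatrix_apply, ContinuousLinearMap.coe_coe,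
    Fintype.sum_sum_type, b, Module.Basis.prod_repr_inl, Module.Basis.prod_repr_inr,
    Pi.basisFun_repr, Module.Basis.prod_apply, Pi.basisFun_apply, Sum.elim_inl, Sum.elim_inr,
    LinearMap.coe_inl, LinearMap.coe_inr, Function.comp_apply]
  simp only [P.fderiv_drift_apply hU hV]
  simp only [Pi.zero_apply, Finset.sum_const_zero, zero_add, mul_zero, neg_zero, zero_sub,
    Pi.single_eq_same, mul_one, Finset.sum_neg_distrib, ← Finset.mul_sum, sum_bathWeight hN]
  ring

/-! ### The generator as a Hörmander-type operator -/

/-- `L f = Y·∇f + γ ∑_i ([i=0] T_L + [i=N-1] T_R) ∂²_{p_i} f` for differentiable `f`.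
[cite: CuneoEckmannHairerReyBellet2018, eq. (3.2)] -/
theorem generator_eq_fderiv_drift_add (N : ℕ) (T_L T_R : ℝ) {f : PhaseSpace N → ℝ}
    (hf : Differentiable ℝ f) (x : PhaseSpace N) :
    P.generator N T_L T_R f x = fderiv ℝ f x (P.drift N x) +
      P.γ * ∑ i, ((if i.val = 0 then T_L else 0) + (if i.val = N - 1 then T_R else 0)) *
        partialP i (partialP i f) x := by
  rw [clm_apply_eq_sum]
  simp only [generator, drift, bathWeight, partialQ_eq_fderiv hf, partialP_eq_fderiv hf,
    smul_eq_mul, Finset.mul_sum, ← Finset.sum_add_distrib, unitQ_eq, unitP_eq]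
  refine Finset.sum_congr rfl fun i _ => ?_
  split_ifs <;> ring

/-! ### CEHR (3.3): the generator applied to `e^{θH}` -/

section Exp

variable {N : ℕ} (T_L T_R θ : ℝ)

/-- `∂_{p_i} e^{θH} = θ p_i e^{θH}` (no hypothesis on the potentials). [folklore] -/
theorem hasLineDerivAt_exp_mul_hamiltonian_unitP (N : ℕ) (θ : ℝ) (x : PhaseSpace N) (i : Fin N) :
    HasLineDerivAt ℝ (fun y => Real.exp (θ * P.hamiltonian N y))
      (Real.exp (θ * P.hamiltonian N x) * (θ * x.2 i)) x ((0, Pi.single i 1) : PhaseSpace N) := by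
  have h := P.hasLineDerivAt_hamiltonian_unitP N x i
  unfold HasLineDerivAt at h ⊢
  have := (h.const_mul θ).exp
  simpa using this

/-- `∂_{p_i} e^{θH} = θ p_i e^{θH}` as an identity of functions. [folklore] -/
theorem partialP_exp_mul_hamiltonian_eq (N : ℕ) (θ : ℝ) (i : Fin N) :
    partialP i (fun y => Real.exp (θ * P.hamiltonian N y)) =
      fun x => θ * x.2 i * Real.exp (θ * P.hamiltonian N x) := by
  funext x
  rw [partialP_eq_lineDeriv, (P.hasLineDerivAt_exp_mul_hamiltonian_unitP N θ x i).lineDeriv]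
  ring

/-- `∂_{p_i} e^{θH} = θ p_i e^{θH}`. [folklore] -/
theorem partialP_exp_mul_hamiltonian (N : ℕ) (θ : ℝ) (x : PhaseSpace N) (i : Fin N) :
    partialP i (fun y => Real.exp (θ * P.hamiltonian N y)) x =
      θ * x.2 i * Real.exp (θ * P.hamiltonian N x) := by
  rw [P.partialP_exp_mul_hamiltonian_eq N θ i]

/-- `∂_{q_i} e^{θH} = θ (∂_{q_i}H) e^{θH}` for a differentiable Hamiltonian. [folklore] -/
theorem partialQ_exp_mul_hamiltonian {N : ℕ} (hH : Differentiable ℝ (P.hamiltonian N)) (θ : ℝ)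
    (x : PhaseSpace N) (i : Fin N) :
    partialQ i (fun y => Real.exp (θ * P.hamiltonian N y)) x =
      θ * partialQ i (P.hamiltonian N) x * Real.exp (θ * P.hamiltonian N x) := by
  have h := P.hasLineDerivAt_hamiltonian_unitQ hH x i
  have h' : HasLineDerivAt ℝ (fun y => Real.exp (θ * P.hamiltonian N y))
      (Real.exp (θ * P.hamiltonian N x) * (θ * partialQ i (P.hamiltonian N) x)) x
      ((Pi.single i 1, 0) : PhaseSpace N) := by
    unfold HasLineDerivAt at h ⊢
    have := (h.const_mul θ).exp
    simpa using this
  rw [partialQ_eq_lineDeriv, h'.lineDeriv]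
  ring

/-- `∂²_{p_i} e^{θH} = θ (1 + θ p_i²) e^{θH}`. [folklore] -/
theorem partialP_partialP_exp_mul_hamiltonian (N : ℕ) (θ : ℝ) (x : PhaseSpace N) (i : Fin N) :
    partialP i (partialP i (fun y => Real.exp (θ * P.hamiltonian N y))) x =
      θ * (1 + θ * x.2 i ^ 2) * Real.exp (θ * P.hamiltonian N x) := by
  rw [P.partialP_exp_mul_hamiltonian_eq N θ i, partialP_eq_lineDeriv]
  have h1 : HasLineDerivAt ℝ (fun y : PhaseSpace N => θ * y.2 i) θ x
      ((0, Pi.single i 1) : PhaseSpace N) := by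
    unfold HasLineDerivAt
    simp only [add_smul_unitP_snd, Pi.add_apply, Pi.smul_apply, Pi.single_eq_same, smul_eq_mul,
      mul_one]
    simpa using ((hasDerivAt_id (0 : ℝ)).const_add (x.2 i)).const_mul θ
  have h2 := P.hasLineDerivAt_exp_mul_hamiltonian_unitP N θ x i
  have h12 : HasLineDerivAt ℝ
      (fun y : PhaseSpace N => θ * y.2 i * Real.exp (θ * P.hamiltonian N y))
      (θ * Real.exp (θ * P.hamiltonian N x) +
        θ * x.2 i * (Real.exp (θ * P.hamiltonian N x) * (θ * x.2 i))) x
      ((0, Pi.single i 1) : PhaseSpace N) := by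
    unfold HasLineDerivAt at h1 h2 ⊢
    have := h1.mul h2
    simpa [Pi.mul_def] using this
  rw [h12.lineDeriv]
  ring

/-- **Cuneo–Eckmann–Hairer–Rey-Bellet 2018, eq. (3.3), PROVED**: for `V = e^{θH}`,
`LV = ∑_{b∈B} θγ_b ([θT_b - 1] p_b² + T_b) e^{θH}` — here for the chain with baths at the
sites `0` (temperature `T_L`) and `N-1` (temperature `T_R`), both acting on the single site when
`N = 1`; the Hamiltonian part `Y_H·∇e^{θH} = θ e^{θH} {H, H} = 0` drops out and each bath
contributes `γ(T_b ∂²_{p_b} - p_b ∂_{p_b}) e^{θH} = θγ([θT_b - 1]p_b² + T_b) e^{θH}`. Requires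
only a differentiable Hamiltonian (`C¹` potentials).
[cite: CuneoEckmannHairerReyBellet2018, §3 eq. (3.3)] -/
theorem generator_exp_mul_hamiltonian {N : ℕ} (hU : ContDiff ℝ 1 P.U) (hV : ContDiff ℝ 1 P.V)
    (T_L T_R θ : ℝ) (x : PhaseSpace N) :
    P.generator N T_L T_R (fun y => Real.exp (θ * P.hamiltonian N y)) x =
      θ * P.γ * Real.exp (θ * P.hamiltonian N x) *
        ∑ i : Fin N, ((if i.val = 0 then (θ * T_L - 1) * x.2 i ^ 2 + T_L else 0) +
          (if i.val = N - 1 then (θ * T_R - 1) * x.2 i ^ 2 + T_R else 0)) := by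
  have hH : Differentiable ℝ (P.hamiltonian N) :=
    (P.contDiff_hamiltonian hU hV N).differentiable one_ne_zero
  simp only [generator, P.partialQ_exp_mul_hamiltonian hH, P.partialP_partialP_exp_mul_hamiltonian,
    P.partialP_exp_mul_hamiltonian, Finset.mul_sum]
  have h0 : ∀ i : Fin N, x.2 i * (θ * partialQ i (P.hamiltonian N) x *
      Real.exp (θ * P.hamiltonian N x)) - partialQ i (P.hamiltonian N) x *
        (θ * x.2 i * Real.exp (θ * P.hamiltonian N x)) = 0 := fun i => by ring
  simp only [h0, Finset.sum_const_zero, zero_add]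
  refine Finset.sum_congr rfl fun i _ => ?_
  split_ifs <;> ring

/-- **Cuneo–Eckmann–Hairer–Rey-Bellet 2018, eq. (3.3), the bound `LV ≤ C_* V`, PROVED**:
for `0 ≤ θ ≤ 1/max(T_L, T_R)` (so `[θT_b - 1] p_b² ≤ 0`), `γ ≥ 0` and `N ≥ 1`,
`L e^{θH} ≤ C_* e^{θH}` pointwise with `C_* = θ ∑_b γ_b T_b = θγ(T_L + T_R)`. This is the
infinitesimal form of (3.4) `P^t V ≤ e^{C_* t} V` (which follows from it by Dynkin's formula
and Gronwall once the process is constructed; not done here).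
[cite: CuneoEckmannHairerReyBellet2018, §3 eq. (3.3)] -/
theorem generator_exp_mul_hamiltonian_le {N : ℕ} (hU : ContDiff ℝ 1 P.U) (hV : ContDiff ℝ 1 P.V)
    (hN : 0 < N) (hγ : 0 ≤ P.γ) {T_L T_R θ : ℝ} (hθ : 0 ≤ θ) (hL : θ * T_L ≤ 1)
    (hR : θ * T_R ≤ 1) (x : PhaseSpace N) :
    P.generator N T_L T_R (fun y => Real.exp (θ * P.hamiltonian N y)) x ≤
      θ * P.γ * (T_L + T_R) * Real.exp (θ * P.hamiltonian N x) := by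
  rw [P.generator_exp_mul_hamiltonian hU hV]
  have hsum : ∑ i : Fin N, ((if i.val = 0 then (θ * T_L - 1) * x.2 i ^ 2 + T_L else 0) +
      (if i.val = N - 1 then (θ * T_R - 1) * x.2 i ^ 2 + T_R else 0)) ≤ T_L + T_R := by
    have hle : ∀ i : Fin N, ((if i.val = 0 then (θ * T_L - 1) * x.2 i ^ 2 + T_L else 0) +
        (if i.val = N - 1 then (θ * T_R - 1) * x.2 i ^ 2 + T_R else 0)) ≤
        (if i.val = 0 then T_L else 0) + (if i.val = N - 1 then T_R else 0) := by
      intro i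
      refine add_le_add ?_ ?_
      · split_ifs
        · nlinarith [sq_nonneg (x.2 i), mul_nonneg (sub_nonneg.2 hL) (sq_nonneg (x.2 i))]
        · exact le_rfl
      · split_ifs
        · nlinarith [sq_nonneg (x.2 i), mul_nonneg (sub_nonneg.2 hR) (sq_nonneg (x.2 i))]
        · exact le_rfl
    refine (Finset.sum_le_sum fun i _ => hle i).trans (le_of_eq ?_)
    rw [Finset.sum_add_distrib]
    have h1 : ∑ i : Fin N, (if i.val = 0 then T_L else 0) = T_L := by
      rw [Finset.sum_eq_single_of_mem (⟨0, hN⟩ : Fin N) (mem_univ _)]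
      · simp
      · intro b _ hb
        rw [if_neg]
        exact fun h => hb (Fin.ext h)
    have h2 : ∑ i : Fin N, (if i.val = N - 1 then T_R else 0) = T_R := by
      rw [Finset.sum_eq_single_of_mem (⟨N - 1, by omega⟩ : Fin N) (mem_univ _)]
      · simp
      · intro b _ hb
        rw [if_neg]
        exact fun h => hb (Fin.ext h)
    rw [h1, h2]
  have hc : 0 ≤ θ * P.γ * Real.exp (θ * P.hamiltonian N x) := by positivity
  calc θ * P.γ * Real.exp (θ * P.hamiltonian N x) * _ ≤
      θ * P.γ * Real.exp (θ * P.hamiltonian N x) * (T_L + T_R) :=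
        mul_le_mul_of_nonneg_left hsum hc
    _ = θ * P.γ * (T_L + T_R) * Real.exp (θ * P.hamiltonian N x) := by ring

end Exp

section Hormander

variable {N : ℕ}

/-- The left and right bath sites `0` and `N - 1` of the `N`-site chain (`N ≥ 1`), indexed by
`Fin 2`. [folklore] -/
def bathSite (hN : 0 < N) : Fin 2 → Fin N :=
  ![⟨0, hN⟩, ⟨N - 1, by omega⟩]

/-- The bath temperatures `T_L, T_R`, indexed by `Fin 2`. [folklore] -/
def bathTemp (T_L T_R : ℝ) : Fin 2 → ℝ := ![T_L, T_R]

/-- The constant noise vector fields `X_b = √(γ T_b) ∂_{p_b}` of the two baths (CEHR §3,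
`X_{b,i} = √(T_b γ_b) ∂_{p_b^i}`), so that `∑_b X_b² = γ (T_L ∂²_{p_0} + T_R ∂²_{p_{N-1}})`.
[cite: CuneoEckmannHairerReyBellet2018, Prop 4.1] -/
def bathField (hN : 0 < N) (T_L T_R : ℝ) (b : Fin 2) (_x : PhaseSpace N) : PhaseSpace N :=
  Real.sqrt (P.γ * bathTemp T_L T_R b) • unitP (bathSite hN b)

/-- The vector field `X₀ = -Y` of the Fokker–Planck operator `L* = ∑_b X_b² - Y + 2γ`
(the formal adjoint of the generator `L = Y + ∑_b X_b²`; `div Y = -2γ`).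
[cite: CuneoEckmannHairerReyBellet2018, §3.1] -/
def adjointDrift (N : ℕ) (x : PhaseSpace N) : PhaseSpace N :=
  -P.drift N x

/-- `ᵗX f = -X f` for a constant vector field `X ≡ v` (its divergence vanishes). [folklore] -/
theorem _root_.Literature.MathematicalPhysics.KineticTheory.HeatConduction.fieldTranspose_const (v : PhaseSpace N)
    (f : PhaseSpace N → ℝ) (x : PhaseSpace N) :
    Literature.Analysis.Distribution.fieldTranspose (fun _ => v) f x = -fderiv ℝ f x v := by
  simp [Literature.Analysis.Distribution.fieldTranspose, Literature.Analysis.Distribution.fieldDeriv, Literature.Analysis.Distribution.fieldDiv]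

/-- `ᵗX (ᵗX f) = s² ∂_u ∂_u f` for the constant field `X ≡ s u`. [folklore] -/
theorem _root_.Literature.MathematicalPhysics.KineticTheory.HeatConduction.fieldTranspose_fieldTranspose_const_smul (s : ℝ)
    (u : PhaseSpace N) {f : PhaseSpace N → ℝ} (hf : ContDiff ℝ ∞ f) (x : PhaseSpace N) :
    Literature.Analysis.Distribution.fieldTranspose (fun _ => s • u) (Literature.Analysis.Distribution.fieldTranspose (fun _ => s • u) f) x =
      s * s * fderiv ℝ (fun y => fderiv ℝ f y u) x u := by
  have h1 : Literature.Analysis.Distribution.fieldTranspose (fun _ => s • u) f = fun y => -(s * fderiv ℝ f y u) := by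
    funext y
    rw [fieldTranspose_const, map_smul, smul_eq_mul]
  rw [fieldTranspose_const, h1]
  have hd : DifferentiableAt ℝ (fun y => fderiv ℝ f y u) x :=
    (((hf.fderiv_right (m := ∞) (by exact_mod_cast le_top)).clm_apply contDiff_const).differentiable
      (by simp)) x
  rw [fderiv_fun_neg, map_smul, fderiv_const_mul hd]
  simp only [neg_apply, FunLike.coe_smul, Pi.smul_apply, smul_eq_mul]
  ring

/-- **The generator is the formal transpose of the Fokker–Planck operator written in Hörmander's
form (1.6)**: with `X₀ = -Y`, `X_b = √(γT_b) ∂_{p_b}` (`b ∈ {L, R}`) and `c = 2γ`, the operator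
`P = ∑_b X_b² + X₀ + c = L*` satisfies `ᵗP f = L f` for every smooth `f` (`γ T_L, γ T_R ≥ 0`).
[cite: CuneoEckmannHairerReyBellet2018, eq. (3.2) and §3.1] -/
theorem hormanderTranspose_eq_generator (hU : ContDiff ℝ ∞ P.U) (hV : ContDiff ℝ ∞ P.V)
    (hN : 0 < N) {T_L T_R : ℝ} (hL : 0 ≤ P.γ * T_L) (hR : 0 ≤ P.γ * T_R) {f : PhaseSpace N → ℝ} (hf : ContDiff ℝ ∞ f) :
    Literature.Analysis.Distribution.hormanderTranspose (P.adjointDrift N) (P.bathField hN T_L T_R) (fun _ => 2 * P.γ) f =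
      P.generator N T_L T_R f := by
  have hfd : Differentiable ℝ f := hf.differentiable (by simp)
  have hfd1 : ∀ i, Differentiable ℝ (partialP i f) := fun i =>
    (contDiff_partialP hf (m := ∞) (by exact_mod_cast le_top) i).differentiable (by simp)
  have hdd : Differentiable ℝ (P.drift N) := (P.contDiff_drift hU hV N).differentiable (by simp)
  funext x
  rw [P.generator_eq_fderiv_drift_add N T_L T_R hfd x, Literature.Analysis.Distribution.hormanderTranspose, Fin.sum_univ_two]
  -- second-order terms
  have hPP : ∀ i, partialP i (partialP i f) x =
      fderiv ℝ (fun y => fderiv ℝ f y (unitP i)) x (unitP i) := fun i => by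
    rw [partialP_eq_fderiv (hfd1 i), partialP_eq_fderiv hfd, unitP_eq]
  have hb : ∀ b : Fin 2, Literature.Analysis.Distribution.fieldTranspose (P.bathField hN T_L T_R b)
      (Literature.Analysis.Distribution.fieldTranspose (P.bathField hN T_L T_R b) f) x =
      P.γ * bathTemp T_L T_R b * partialP (bathSite hN b) (partialP (bathSite hN b) f) x := by
    intro b
    unfold bathField
    rw [fieldTranspose_fieldTranspose_const_smul _ _ hf, hPP, Real.mul_self_sqrt]
    fin_cases b
    · exact hL
    · exact hR
  -- first-order term: `ᵗX₀ f = Y·∇f - 2γ f`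
  have h0 : Literature.Analysis.Distribution.fieldTranspose (P.adjointDrift N) f x = fderiv ℝ f x (P.drift N x) - 2 * P.γ * f x := by
    have e1 : Literature.Analysis.Distribution.fieldDiv (P.adjointDrift N) x = 2 * P.γ := by
      have : P.adjointDrift N = fun y => -P.drift N y := rfl
      rw [Literature.Analysis.Distribution.fieldDiv, this, fderiv_fun_neg]
      simp only [ContinuousLinearMap.toLinearMap_neg, map_neg]
      rw [show LinearMap.trace ℝ _ (fderiv ℝ (P.drift N) x : PhaseSpace N →ₗ[ℝ] PhaseSpace N) =
        Literature.Analysis.Distribution.fieldDiv (P.drift N) x from rfl, P.fieldDiv_drift hU hV hN]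
      ring
    rw [Literature.Analysis.Distribution.fieldTranspose, Literature.Analysis.Distribution.fieldDeriv, e1, adjointDrift, map_neg]
    ring
  rw [hb, hb, h0]
  -- the sum over sites of the generator picks the two bath sites
  have hsum : ∑ i : Fin N, ((if i.val = 0 then T_L else 0) + (if i.val = N - 1 then T_R else 0)) *
      partialP i (partialP i f) x =
      T_L * partialP (bathSite hN 0) (partialP (bathSite hN 0) f) x +
        T_R * partialP (bathSite hN 1) (partialP (bathSite hN 1) f) x := by
    simp only [add_mul, Finset.sum_add_distrib]
    congr 1
    · rw [Finset.sum_eq_single_of_mem (bathSite hN 0) (mem_univ _)]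
      · simp [bathSite]
      · intro b _ hb
        rw [if_neg, zero_mul]
        exact fun h => hb (Fin.ext (by simpa [bathSite] using h))
    · rw [Finset.sum_eq_single_of_mem (bathSite hN 1) (mem_univ _)]
      · simp [bathSite]
      · intro b _ hb
        rw [if_neg, zero_mul]
        exact fun h => hb (Fin.ext (by simpa [bathSite] using h))
  rw [hsum]
  simp only [bathTemp, Matrix.cons_val_zero, Matrix.cons_val_one]
  ring

end Hormander

/-! ### CEHR Proposition 4.1: the bracket condition for the chain -/

/-- The family `(X₀ = -Y, X_L, X_R)` of Hörmander's Theorem 1.1 for the Fokker–Planck operator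
`L* = X_L² + X_R² + X₀ + 2γ` of the chain, indexed by `Option (Fin 2)` as in
`Literature.Analysis.Distribution.Hormander1967_thm11`. [cite: CuneoEckmannHairerReyBellet2018, Prop 4.1] -/
def hormanderFamily (hN : 0 < N) (T_L T_R : ℝ) : Option (Fin 2) → PhaseSpace N → PhaseSpace N :=
  fun o => o.elim (P.adjointDrift N) (P.bathField hN T_L T_R)

/-- The iterated brackets `Z_0 = X_L`, `Z_{k+1} = [X₀, Z_k]` along which the bracket condition is
verified (CEHR, proof of Prop. 4.1: commutators with `X₀` propagate `∂_{p_0}` through the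
chain). [cite: CuneoEckmannHairerReyBellet2018, Prop 4.1] -/
def bracketSeq (hN : 0 < N) (T_L T_R : ℝ) : ℕ → PhaseSpace N → PhaseSpace N
  | 0 => P.bathField hN T_L T_R 0
  | k + 1 => VectorField.lieBracket ℝ (P.adjointDrift N) (bracketSeq hN T_L T_R k)

section Brackets

variable (hN : 0 < N) (T_L T_R : ℝ)

/-- Each `Z_k` is an iterated Lie bracket of the family `(X₀, X_L, X_R)`. [folklore] -/
theorem isIteratedLieBracket_bracketSeq (k : ℕ) :
    Literature.Analysis.Distribution.IsIteratedLieBracket (P.hormanderFamily hN T_L T_R) (P.bracketSeq hN T_L T_R k) := by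
  induction k with
  | zero => exact Literature.Analysis.Distribution.IsIteratedLieBracket.of (some 0)
  | succ k ih => exact Literature.Analysis.Distribution.IsIteratedLieBracket.lieBracket none ih

/-- The adjoint drift `-Y` is smooth. [folklore] -/
theorem contDiff_adjointDrift (hU : ContDiff ℝ ∞ P.U) (hV : ContDiff ℝ ∞ P.V) (N : ℕ) :
    ContDiff ℝ ∞ (P.adjointDrift N) :=
  (P.contDiff_drift hU hV N).neg

/-- The recursion `Z_{k+1}(x) = DZ_k(x)·X₀(x) + DY(x)·Z_k(x)` (`[X₀, Z] = DZ·X₀ - DX₀·Z` with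
`X₀ = -Y`). [folklore] -/
theorem bracketSeq_succ_apply (k : ℕ) (x : PhaseSpace N) :
    P.bracketSeq hN T_L T_R (k + 1) x =
      fderiv ℝ (P.bracketSeq hN T_L T_R k) x (P.adjointDrift N x) +
        fderiv ℝ (P.drift N) x (P.bracketSeq hN T_L T_R k x) := by
  show VectorField.lieBracket ℝ (P.adjointDrift N) (P.bracketSeq hN T_L T_R k) x = _
  rw [VectorField.lieBracket_eq]
  have : P.adjointDrift N = fun y => -P.drift N y := rfl
  simp only [this, fderiv_fun_neg, neg_apply, sub_neg_eq_add]

omit hN in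
/-- If a momentum coordinate of a vector field vanishes identically, so does that coordinate of
its derivative. [folklore] -/
theorem _root_.Literature.MathematicalPhysics.KineticTheory.HeatConduction.fderiv_apply_snd_eq_zero {Z : PhaseSpace N → PhaseSpace N}
    {i : Fin N} (h : ∀ y, (Z y).2 i = 0) (x w : PhaseSpace N) : (fderiv ℝ Z x w).2 i = 0 := by
  by_cases hZ : DifferentiableAt ℝ Z x
  · let L : PhaseSpace N →L[ℝ] ℝ :=
      (ContinuousLinearMap.proj i).comp (ContinuousLinearMap.snd ℝ (Fin N → ℝ) (Fin N → ℝ))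
    have h1 : (fun y => L (Z y)) = fun _ => 0 := funext h
    have h2 : fderiv ℝ (fun y => L (Z y)) x = L.comp (fderiv ℝ Z x) :=
      (L.hasFDerivAt.comp x hZ.hasFDerivAt).fderiv
    have h3 : L (fderiv ℝ Z x w) = fderiv ℝ (fun y => L (Z y)) x w := by rw [h2]; rfl
    show L (fderiv ℝ Z x w) = 0
    rw [h3, h1, fderiv_const_apply]
    rfl
  · rw [fderiv_zero_of_not_differentiableAt hZ]
    rfl

omit hN in
/-- If a position coordinate of a vector field vanishes identically, so does that coordinate of
its derivative. [folklore] -/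
theorem _root_.Literature.MathematicalPhysics.KineticTheory.HeatConduction.fderiv_apply_fst_eq_zero {Z : PhaseSpace N → PhaseSpace N}
    {i : Fin N} (h : ∀ y, (Z y).1 i = 0) (x w : PhaseSpace N) : (fderiv ℝ Z x w).1 i = 0 := by
  by_cases hZ : DifferentiableAt ℝ Z x
  · let L : PhaseSpace N →L[ℝ] ℝ :=
      (ContinuousLinearMap.proj i).comp (ContinuousLinearMap.fst ℝ (Fin N → ℝ) (Fin N → ℝ))
    have h1 : (fun y => L (Z y)) = fun _ => 0 := funext h
    have h2 : fderiv ℝ (fun y => L (Z y)) x = L.comp (fderiv ℝ Z x) :=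
      (L.hasFDerivAt.comp x hZ.hasFDerivAt).fderiv
    have h3 : L (fderiv ℝ Z x w) = fderiv ℝ (fun y => L (Z y)) x w := by rw [h2]; rfl
    show L (fderiv ℝ Z x w) = 0
    rw [h3, h1, fderiv_const_apply]
    rfl
  · rw [fderiv_zero_of_not_differentiableAt hZ]
    rfl

/-- **The triangular structure of the brackets** (CEHR, proof of Prop. 4.1 for the chain): with
the coordinate directions ranked `p_0 ≺ q_0 ≺ p_1 ≺ q_1 ≺ ⋯` (rank `2i` for `p_i`, `2i+1` for
`q_i`), the bracket `Z_k = [X₀, [X₀, …, X_L]]` is smooth, has identically vanishing coordinates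
of rank `> k`, and its rank-`k` coordinate vanishes NOWHERE: it is `±√(γT_L) ∏ V''(q_{j+1}-q_j)`
over the bonds crossed, and `V'' ≠ 0`. [cite: CuneoEckmannHairerReyBellet2018, Prop 4.1] -/
theorem bracketSeq_triangular (hU : ContDiff ℝ ∞ P.U) (hV : ContDiff ℝ ∞ P.V)
    (hγL : 0 < P.γ * T_L) (hV2 : ∀ r, deriv (deriv P.V) r ≠ 0) (k : ℕ) :
    ContDiff ℝ ∞ (P.bracketSeq hN T_L T_R k) ∧
    (∀ i : Fin N, k < 2 * i.val → ∀ x, (P.bracketSeq hN T_L T_R k x).2 i = 0) ∧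
    (∀ i : Fin N, k < 2 * i.val + 1 → ∀ x, (P.bracketSeq hN T_L T_R k x).1 i = 0) ∧
    (∀ i : Fin N, k = 2 * i.val → ∀ x, (P.bracketSeq hN T_L T_R k x).2 i ≠ 0) ∧
    (∀ i : Fin N, k = 2 * i.val + 1 → ∀ x, (P.bracketSeq hN T_L T_R k x).1 i ≠ 0) := by
  induction k with
  | zero =>
    have h0 : ∀ x, P.bracketSeq hN T_L T_R 0 x = Real.sqrt (P.γ * T_L) • unitP ⟨0, hN⟩ :=
      fun x => rfl
    refine ⟨contDiff_const, fun i hi x => ?_, fun i _ x => ?_, fun i hi x => ?_, fun i hi _ => ?_⟩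
    · have hi0 : i ≠ ⟨0, hN⟩ := by intro e; subst e; simp at hi
      simp [h0, hi0]
    · simp [h0]
    · have hi0 : i = ⟨0, hN⟩ := Fin.ext (by change i.val = 0; omega)
      subst hi0
      simp [h0, Real.sqrt_ne_zero'.2 hγL]
    · omega
  | succ k ih =>
    obtain ⟨h1, h2, h3, h4, h5⟩ := ih
    have hrec := P.bracketSeq_succ_apply hN T_L T_R k
    -- components of the recursion
    have hfst : ∀ x i, (P.bracketSeq hN T_L T_R (k + 1) x).1 i =
        (fderiv ℝ (P.bracketSeq hN T_L T_R k) x (P.adjointDrift N x)).1 i +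
          (P.bracketSeq hN T_L T_R k x).2 i := fun x i => by
      rw [hrec, P.fderiv_drift_apply hU hV]
      rfl
    have hsnd : ∀ x i, (P.bracketSeq hN T_L T_R (k + 1) x).2 i =
        (fderiv ℝ (P.bracketSeq hN T_L T_R k) x (P.adjointDrift N x)).2 i +
          (-(∑ j, P.hessPotential N i j x.1 * (P.bracketSeq hN T_L T_R k x).1 j) -
            P.γ * bathWeight N i * (P.bracketSeq hN T_L T_R k x).2 i) := fun x i => by
      rw [hrec, P.fderiv_drift_apply hU hV]
      rfl
    refine ⟨?_, fun i hi x => ?_, fun i hi x => ?_, fun i hi x => ?_, fun i hi x => ?_⟩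
    · -- smoothness
      exact (P.contDiff_adjointDrift hU hV N).lieBracket_vectorField h1
        (by exact_mod_cast le_top)
    · -- vanishing of the `p_i` coordinate for `k + 1 < 2 i`
      rw [hsnd, fderiv_apply_snd_eq_zero (h2 i (by omega)), h2 i (by omega) x, mul_zero,
        sub_zero, zero_add, neg_eq_zero]
      refine Finset.sum_eq_zero fun j _ => ?_
      by_cases hj : k < 2 * j.val + 1
      · rw [h3 j hj x, mul_zero]
      · rw [P.hessPotential_eq_zero_of_le N (by omega) x.1, zero_mul]
    · -- vanishing of the `q_i` coordinate for `k + 1 < 2 i + 1`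
      rw [hfst, fderiv_apply_fst_eq_zero (h3 i (by omega)), h2 i (by omega) x, add_zero]
    · -- non-vanishing of the `p_i` coordinate for `k + 1 = 2 i` (`i ≥ 1`)
      have hi1 : 1 ≤ i.val := by omega
      set i' : Fin N := ⟨i.val - 1, by omega⟩ with hi'
      rw [hsnd, fderiv_apply_snd_eq_zero (h2 i (by omega)), h2 i (by omega) x, mul_zero,
        sub_zero, zero_add, neg_ne_zero, Finset.sum_eq_single_of_mem i' (mem_univ _)]
      · refine mul_ne_zero ?_ (h5 i' (by simp [hi']; omega) x)
        rw [P.hessPotential_succ N (by simp [hi']; omega)]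
        exact neg_ne_zero.2 (hV2 _)
      · intro j _ hj
        by_cases hjk : k < 2 * j.val + 1
        · rw [h3 j hjk x, mul_zero]
        · have : j.val + 2 ≤ i.val := by
            have : j.val ≠ i.val - 1 := fun e => hj (Fin.ext (by simp [hi', e]))
            omega
          rw [P.hessPotential_eq_zero_of_le N this x.1, zero_mul]
    · -- non-vanishing of the `q_i` coordinate for `k + 1 = 2 i + 1`
      rw [hfst, fderiv_apply_fst_eq_zero (h3 i (by omega)), zero_add]
      exact h4 i (by omega) x

/-- **Cuneo–Eckmann–Hairer–Rey-Bellet 2018, Proposition 4.1, for the chain, PROVED** ("Under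
Conditions C1 and C2, the system (2.2) satisfies H1"): for an oscillator chain with smooth
potentials, nowhere-vanishing `V''` (non-degenerate interaction, C2 with `ℓ = 1`) and a genuine
left bath (`γ T_L > 0`; the chain is controlled by one end, C1), the iterated brackets of
`X₀ = -Y` with `X_L = √(γT_L) ∂_{p_0}` span the whole phase space at every point — Hörmander's
bracket condition for `L*` (equivalently for `L`, whose fields `Y, X_b` generate the same
brackets up to sign). [cite: CuneoEckmannHairerReyBellet2018, Prop 4.1] -/
theorem isBracketGenerating_hormanderFamily (hU : ContDiff ℝ ∞ P.U) (hV : ContDiff ℝ ∞ P.V)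
    (hγL : 0 < P.γ * T_L) (hV2 : ∀ r, deriv (deriv P.V) r ≠ 0) :
    Literature.Analysis.Distribution.IsBracketGenerating (P.hormanderFamily hN T_L T_R) univ := by
  intro x _
  set S : Submodule ℝ (PhaseSpace N) := Submodule.span ℝ
    {v | ∃ V, Literature.Analysis.Distribution.IsIteratedLieBracket (P.hormanderFamily hN T_L T_R) V ∧ V x = v} with hS
  have hZ : ∀ k, S.mkQ (P.bracketSeq hN T_L T_R k x) = 0 := fun k => by
    rw [Submodule.mkQ_apply, Submodule.Quotient.mk_eq_zero]
    exact Submodule.subset_span ⟨_, P.isIteratedLieBracket_bracketSeq hN T_L T_R k, rfl⟩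
  have hT := P.bracketSeq_triangular hN T_L T_R hU hV hγL hV2
  -- every coordinate vector is in `S`, by strong induction on the site index
  have key : ∀ m : ℕ, ∀ i : Fin N, i.val = m → S.mkQ (unitP i) = 0 ∧ S.mkQ (unitQ i) = 0 := by
    intro m
    induction m using Nat.strong_induction_on with
    | _ m ih =>
      intro i him
      -- expand `Z_k x` in coordinates and push through the quotient map
      have hexp : ∀ k, (∑ j, (P.bracketSeq hN T_L T_R k x).1 j • S.mkQ (unitQ j)) +
          ∑ j, (P.bracketSeq hN T_L T_R k x).2 j • S.mkQ (unitP j) = 0 := fun k => by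
        have := hZ k
        rw [eq_sum_unitQ_add_sum_unitP (P.bracketSeq hN T_L T_R k x)] at this
        simpa only [map_add, map_sum, map_smul] using this
      -- the `p_i` direction, from `Z_{2m}`
      have hPi : S.mkQ (unitP i) = 0 := by
        obtain ⟨-, h2, h3, h4, -⟩ := hT (2 * m)
        have e := hexp (2 * m)
        rw [Finset.sum_eq_zero, zero_add, Finset.sum_eq_single_of_mem i (mem_univ _)] at e
        · exact (smul_eq_zero.1 e).resolve_left (h4 i (by omega) x)
        · intro j _ hj
          by_cases hjm : 2 * m < 2 * j.val
          · rw [h2 j hjm x, zero_smul]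
          · rw [(ih j.val (by have : j.val ≠ m := fun e => hj (Fin.ext (by omega)); omega)
              j rfl).1, smul_zero]
        · intro j _
          by_cases hjm : 2 * m < 2 * j.val + 1
          · rw [h3 j hjm x, zero_smul]
          · rw [(ih j.val (by omega) j rfl).2, smul_zero]
      refine ⟨hPi, ?_⟩
      -- the `q_i` direction, from `Z_{2m+1}`
      obtain ⟨-, h2, h3, -, h5⟩ := hT (2 * m + 1)
      have e := hexp (2 * m + 1)
      rw [Finset.sum_eq_single_of_mem i (mem_univ _), Finset.sum_eq_zero, add_zero] at e
      · exact (smul_eq_zero.1 e).resolve_left (h5 i (by omega) x)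
      · intro j _
        by_cases hjm : 2 * m + 1 < 2 * j.val
        · rw [h2 j hjm x, zero_smul]
        · rcases Nat.lt_or_ge j.val m with hlt | hge
          · rw [(ih j.val hlt j rfl).1, smul_zero]
          · have : j = i := Fin.ext (by omega)
            rw [this, hPi, smul_zero]
      · intro j _ hj
        by_cases hjm : 2 * m + 1 < 2 * j.val + 1
        · rw [h3 j hjm x, zero_smul]
        · rw [(ih j.val (by have : j.val ≠ m := fun e => hj (Fin.ext (by omega)); omega)
            j rfl).2, smul_zero]
  -- conclude `S = ⊤`
  have hmem : ∀ v, S.mkQ v = 0 → v ∈ S := fun v hv => by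
    rwa [Submodule.mkQ_apply, Submodule.Quotient.mk_eq_zero] at hv
  rw [eq_top_iff]
  rintro v -
  rw [eq_sum_unitQ_add_sum_unitP v]
  exact add_mem (Submodule.sum_mem _ fun i _ => Submodule.smul_mem _ _ (hmem _ (key _ i rfl).2))
    (Submodule.sum_mem _ fun i _ => Submodule.smul_mem _ _ (hmem _ (key _ i rfl).1))

end Brackets

end OscillatorChain

/-! ### The smooth-density fact from Hörmander's theorem -/

/-- `V''(r) = 1 + 3βr² ≠ 0` for the pinned chain with `β ≥ 0` (Condition C2 with `ℓ = 1`).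
[folklore] -/
theorem pinnedChain_deriv_deriv_V (ω₂ lam β γ r : ℝ) :
    deriv (deriv (pinnedChain ω₂ lam β γ).V) r = 1 + 3 * β * r ^ 2 := by
  have h1 : deriv (pinnedChain ω₂ lam β γ).V = fun r => r + β * r ^ 3 :=
    funext (pinnedChain_deriv_V ω₂ lam β γ)
  rw [h1]
  have h : HasDerivAt (fun r : ℝ => r + β * r ^ 3) (1 + β * ((3 : ℕ) * r ^ (3 - 1))) r :=
    (hasDerivAt_id r).add ((hasDerivAt_pow 3 r).const_mul β)
  rw [h.deriv]
  norm_num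
  ring

/-- **`CuneoEckmannHairerReyBellet2018_smoothDensity` from Hörmander's Theorem 1.1, PROVED.**
For the pinned chain (`ω₂, β, γ > 0`, `lam ≥ 0`, `N ≥ 1`, `T_L, T_R > 0`), a finite Borel
measure `μ` with `∫ L f dμ = 0` for all `f ∈ C_c^∞` is, read as a distribution, a solution of
`L* μ = 0` (`⟨L*μ, φ⟩ = ⟨μ, ᵗ(L*)φ⟩ = ∫ Lφ dμ = 0`, `hormanderTranspose_eq_generator`), where
`L* = X_L² + X_R² - Y + 2γ` is of Hörmander's form (1.6) and satisfies the bracket condition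
everywhere (`isBracketGenerating_hormanderFamily`, CEHR Prop. 4.1, since `V'' = 1 + 3βr² > 0`
and `γ T_L > 0`); by Theorem 1.1 `μ` is a smooth function, i.e. `μ` has a smooth density
(`Hormander1967_thm11.exists_eq_withDensity`). So the chain-specific content of the
smooth-density fact is proved, and what remains assumed is exactly Hörmander's theorem.
[cite: Hormander1967, Thm 1.1] [cite: CuneoEckmannHairerReyBellet2018, Prop 3.2 and Prop 4.1] -/
theorem CuneoEckmannHairerReyBellet2018_smoothDensity_of_hormander (hH : Literature.Analysis.Distribution.Hormander1967_thm11) :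
    CuneoEckmannHairerReyBellet2018_smoothDensity := by
  intro ω₂ lam β γ hω hl hβ hγ N T_L T_R hN hL hR μ hμ hstat
  set P := pinnedChain ω₂ lam β γ with hP
  have hU : ContDiff ℝ ∞ P.U := pinnedChain_contDiff_U ω₂ lam β γ
  have hV : ContDiff ℝ ∞ P.V := pinnedChain_contDiff_V ω₂ lam β γ
  have hγ' : P.γ = γ := rfl
  have hγL : 0 < P.γ * T_L := by rw [hγ']; positivity
  have hV2 : ∀ r, deriv (deriv P.V) r ≠ 0 := fun r => by
    rw [hP, pinnedChain_deriv_deriv_V]; positivity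
  haveI := isAddHaarMeasure_volume_phaseSpace N
  obtain ⟨g, hg, hg0, hμg⟩ := hH.exists_eq_withDensity (volume : Measure (PhaseSpace N))
    (X₀ := P.adjointDrift N) (X := P.bathField hN T_L T_R) (c := fun _ => 2 * P.γ)
    (P.contDiff_adjointDrift hU hV N) (fun _ => contDiff_const) contDiff_const
    (P.isBracketGenerating_hormanderFamily hN T_L T_R hU hV hγL hV2) μ
    (fun φ hφ hφc => by
      rw [P.hormanderTranspose_eq_generator hU hV hN (by rw [hγ']; positivity)
        (by rw [hγ']; positivity) hφ]
      exact hstat φ hφ hφc)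
  exact ⟨g, hg, hg0, hμg⟩

/-- **Assembly**: the weak-stationarity fact `CuneoEckmannHairerReyBellet2018_pinnedChain` from
the Lyapunov/semigroup fact and Hörmander's Theorem 1.1 (via
`CuneoEckmannHairerReyBellet2018_pinnedChain_of_lyapunov_of_smoothDensity` of
`LangevinChainLyapunov.lean`). [cite: CuneoEckmannHairerReyBellet2018, Thm 2.13]
[cite: Hormander1967, Thm 1.1] -/
theorem CuneoEckmannHairerReyBellet2018_pinnedChain_of_lyapunov_of_hormander
    (h₂ : CuneoEckmannHairerReyBellet2018_lyapunov) (hH : Literature.Analysis.Distribution.Hormander1967_thm11) :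
    CuneoEckmannHairerReyBellet2018_pinnedChain :=
  CuneoEckmannHairerReyBellet2018_pinnedChain_of_lyapunov_of_smoothDensity h₂
    (CuneoEckmannHairerReyBellet2018_smoothDensity_of_hormander hH)

end Literature.MathematicalPhysics.KineticTheory.HeatConduction
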